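import Literature.IUT.LogVolume.Corollary22Legendre
import Literature.IUT.LogVolume.Corollary22TateInput
import Literature.IUT.LogVolume.Corollary22PartI
import Literature.NumberTheory.DiophantineGeometry.GenEllLCyclicHeightBound
import Literature.NumberTheory.DiophantineGeometry.GenEllImageModLContainsSL2
import Literature.NumberTheory.DiophantineGeometry.GenEllMellReduction
import Literature.NumberTheory.EllipticCurves.HeightsBaseChangeProofs
import Literature.NumberTheory.NumberFields.UnramifiedDescentPrimeDegree
import Mathlib.NumberTheory.RamificationInertia.Valuation
import HarnessLib

/-!
# [IUTchIV] Cor. 2.2 (ii), the classical Galois-image input (P4) ⇒ (P6): `Cor22.FullGaloisImage`, PROVED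

Mochizuki, *Inter-universal Teichmüller theory IV*, RIMS manuscript (Apr. 2020; = PRIMS **57** (2021)),
proof of Cor. 2.2 (ii), pp. 45–46, read on the page:

> (P4) `E_F` does not admit an `l`-cyclic subgroup scheme. Indeed, the existence of an `l`-cyclic
> subgroup scheme of `E_F` would imply that `((l−2)/24)·log(q^∀) ≤ 2·log(l) + T_K` [(i), (P2), [GenEll]
> Lem. 3.5, Prop. 3.4] … hence that … `log(q^∀)` is bounded …
> (P6) … follows formally from (P2), (P4), and [GenEll], Lemma 3.1, (iii) [given the multiplicative place
> of (P5)].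

This proof-only file proves the content of the named classical interface `Cor22.FullGaloisImage` of
`Corollary22Legendre.lean` (abc-iut-S-d2) in its rev-2 form (primes `l ≥ 7`; at `l = 5` the conclusion
fails since `E[5] ⊆ E(F)`, and the prime of the printed proof is `≥ √h > 5` anyway):
`condP6_of_seven_le` — for every compactly bounded `K_V` there is `H_K` such that for `λ ∈ K_V ∩ U_X`,
primes `l ≥ 7` with (P2), (P5) and `h = log(q^∀(λ)) > H_K`, condition (P6) holds, i.e. for EVERY
theta-field `F = F_tpd(√−1, E[3·5])` (`IsThetaField`) the image of `Gal(F̄/F)` on `E_F[l]` contains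
`SL₂(𝔽_l)`. (`Cor22.fullGaloisImage_holds : FullGaloisImage` is then `condP6_of_seven_le` verbatim, once
rev 2 of the interface is in the tree; against rev 1 — `l ≥ 5` — the interface is not provable.)

The proof is the printed one, assembled from theorems of the tree (nothing is assumed). The dictionary
between the `λ`-line and [GenEll] §3 is stated for an ARBITRARY presented curve `Q = E_{F'}` over an
extension `F' ⊇ F_tpd` with `j(E_{F'}) = j(λ)` (so that it applies verbatim to `Q := thetaEllPoint P hU F`):
* `thetaCurve_j`: `j(E_F) = j(λ)` (`Cor22.j_legendre`); `htInf_eq_htInfty`: `ht_∞([Q]) = ht_∞(λ)` (base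
  change of the Weil height, `NumberField.logHeight₁_algebraMap`); `norm_j_le_of_mem`: on `K_V` the
  conjugates of `j(Q)` are bounded (`Cor22.exists_jInv_bound`); `localHeight_eq_mul`: the local heights of
  `Q` are `h_w = e(w|v)·(−ord_v j(λ))` (Mathlib `valuation_liesOver`), and `e(w|v) ∣ [F' : F_tpd] ∣ 46080 =
  2^{10}·3^2·5` for Galois `F'` (`ramificationIdx_dvd_finrank_of_isGalois`), so (P2) over `F_tpd` gives "`l`
  prime to the local heights of `Q`" for `l ≥ 7` (`not_dvd_localHeight_of_condP2`);
* (P4): [GenEll] Lem. 3.5 + Prop. 3.4 in the form `exists_htInf_le_of_admitsLCyclic` (abc-iut-S-d4, over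
  `GenEll_lemma35_general`), and `log(q^∀) ≤ ht_∞` (`Cor22.logQForall_le_htInfty`, part of (i));
* (P6): the (P5) place `v ∤ 2l` of `F_tpd` lifts to a place `w ∤ l` of `F'`, of multiplicative reduction
  because `Q` is semistable ([IUTchIV] Prop. 1.8 (v) = field `IsThetaField.isSemistable`) with `h_w > 0`;
  there the Tate-curve transvection and [GenEll] Lem. 3.1 (iii) apply in the form
  `EllPoint.imageModLContainsSL2_of_not_admitsLCyclic_of_hasMultiplicativeReductionAt` (abc-iut-S-d4/S5).

Classical throughout; `Cor22.Thm110Legendre` (the disputed chain) is not touched. TAKES NO SIDE on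
[IUTchIII] Cor. 3.12. Proof-only file: theorems only, no definitions, no named facts.
-/

noncomputable section

open scoped Classical

namespace Literature.IUT.LogVolume

namespace Cor22

open NumberField IsDedekindDomain Literature.NumberTheory.DiophantineGeometry.GenEll
open Literature.NumberTheory.EllipticCurves

/-! ## The Legendre curve over a theta-field: `j(E_F) = j(λ)` -/

section ThetaCurve

variable {P : NFPoint} (F : Type) [Field F] [NumberField F] [Algebra P.F F]

/-- `j(E_F) = j(λ)` read in `F`: the `j`-invariant of the Legendre curve `y² = x(x−1)(x−λ)` over
`F ⊇ F_tpd` is `2⁸(λ²−λ+1)³/(λ²(λ−1)²)` (`Cor22.j_legendre`, Silverman *AEC* III.1.7 (b)), i.e. the image of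
`jInv λ ∈ F_tpd`. [cite: SilvermanAEC2009, Prop. III.1.7(b)] -/
theorem thetaCurve_j (hU : P.InU) :
    letI := thetaCurve_isElliptic hU F
    (thetaCurve P F).j = algebraMap P.F F (jInv P.x) := by
  letI := thetaCurve_isElliptic hU F
  haveI : (⟨0, -(1 + (extend P F).x), 0, (extend P F).x, 0⟩ : WeierstrassCurve (extend P F).F).IsElliptic :=
    thetaCurve_isElliptic hU F
  have h := j_legendre (extend P F) (extend_inU hU F)
  rw [map_jInv]
  exact h

end ThetaCurve

/-! ## The `λ`-line ↔ `M_ell` dictionary for a presented curve with `j = j(λ)` over `F' ⊇ F_tpd` -/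

section Dictionary

variable {P : NFPoint} (Q : EllPoint) [Algebra P.F Q.F] (hj : Q.W.j = algebraMap P.F Q.F (jInv P.x))
include hj

/-- **The conjugates of `j` are bounded on `K_V`**: if `λ ∈ K_V` (all complex conjugates of `λ` in the
compact `K_∞ ⊆ ℂ ∖ {0,1}`), `‖j(z)‖ ≤ C` on `K_∞` (`Cor22.exists_jInv_bound`) and `j(Q) = j(λ)`, then
`‖σ(j(Q))‖ ≤ C` for every embedding `σ : F' → ℂ` (the "`T_K`" of p. 45: "`ht_∞` … is bounded … since
`[E_L] ∈ K_V`"). [cite: Mochizuki2012, IUTchIV Cor 2.2 proof (P4) p.45] -/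
theorem norm_j_le_of_mem {D : CBData} (hPD : D.Mem P) {C : ℝ} (hC : ∀ z ∈ D.Karc, ‖jInv z‖ ≤ C)
    (σ : Q.F →+* ℂ) : ‖σ Q.W.j‖ ≤ C := by
  rw [hj, ← RingHom.comp_apply, map_jInv]
  exact hC _ (hPD.1 (σ.comp (algebraMap P.F Q.F)))

/-- **`ht_∞([Q]) = ht_∞(λ)`** when `j(Q) = j(λ)`: the normalised Weil height of `j` does not depend on the
field over which the point is presented (`h_{F'}(j) = [F' : F_tpd]·h_{F_tpd}(j)`, Silverman *AEC*
VIII.5.4 (b), the tree's `NumberField.logHeight₁_algebraMap`). [cite: SilvermanAEC2009, Prop. VIII.5.4(b)] -/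
theorem htInf_eq_htInfty : Q.htInf = htInfty P := by
  haveI : IsScalarTower ℚ P.F Q.F := IsScalarTower.of_algebraMap_eq fun q => by simp
  unfold EllPoint.htInf htInfty EllPoint.degree NFPoint.degree
  rw [hj, NumberField.logHeight₁_algebraMap, ← Module.finrank_mul_finrank ℚ P.F Q.F, Nat.cast_mul]
  have h1 : (0 : ℝ) < Module.finrank ℚ P.F := by exact_mod_cast Module.finrank_pos
  have h2 : (0 : ℝ) < Module.finrank P.F Q.F := by exact_mod_cast Module.finrank_pos
  field_simp

/-- **Local heights of `Q` over the pole orders of `j(λ)`**: for a finite place `w` of `F'` over the place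
`v` of `F_tpd`, `h_w(Q) = e(w|v)·(−ord_v j(λ))` — `h_w = −ord_w j(Q)` ([GenEll] Def. 3.3,
`EllPoint.localHeight`), `j(Q) = j(λ)`, and `ord_w ∘ (F_tpd ↪ F') = e(w|v)·ord_v` (Mathlib
`valuation_liesOver`). [cite: MochizukiGenEll2010, Rmk 3.3.1 p.16] -/
theorem localHeight_eq_mul (w : HeightOneSpectrum (𝓞 Q.F)) (v : HeightOneSpectrum (𝓞 P.F))
    [w.asIdeal.LiesOver v.asIdeal] :
    Q.localHeight w = (v.asIdeal.ramificationIdx' w.asIdeal : ℤ) * (-ord P.F v (jInv P.x)) := by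
  rw [EllPoint.localHeight_eq_log, hj,
    ← IsDedekindDomain.HeightOneSpectrum.valuation_liesOver Q.F v w (jInv P.x), WithZero.log_pow,
    nsmul_eq_mul]
  simp only [ord, neg_neg]

omit hj in
/-- A prime `l ≥ 7` does not divide `46080 = 2^{10}·3^2·5` (the bound `|ℤ/2 × GL₂(𝔽₃) × GL₂(𝔽₅)|` on
`[F : F_tpd]`, `IsThetaField.finrank_dvd`). [folklore] -/
private theorem not_dvd_46080_of_prime_of_seven_le {l : ℕ} (hl : l.Prime) (h7 : 7 ≤ l) : ¬ l ∣ 46080 := by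
  intro h
  have h' : l ∣ 2 ^ 10 * 3 ^ 2 * 5 := by norm_num; exact h
  rcases (Nat.Prime.dvd_mul hl).mp h' with h23 | h5
  · rcases (Nat.Prime.dvd_mul hl).mp h23 with h2 | h3
    · have := (Nat.prime_dvd_prime_iff_eq hl Nat.prime_two).mp (hl.dvd_of_dvd_pow h2); omega
    · have := (Nat.prime_dvd_prime_iff_eq hl Nat.prime_three).mp (hl.dvd_of_dvd_pow h3); omega
  · have := (Nat.prime_dvd_prime_iff_eq hl Nat.prime_five).mp h5; omega

/-- **(P2) over `F_tpd` gives "`l` prime to the local heights of `Q`" for primes `l ≥ 7`** when `F'/F_tpd`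
is Galois of degree dividing `46080` (the step the printed proof leaves implicit when it applies [GenEll]
Lem. 3.5 to `E_F`; cf. the docstring of `Cor22.CondP2`): at a place `w` of `F'` of multiplicative reduction,
`h_w = e(w|v)·(−ord_v j(λ)) > 0` with `l ∤ ord_v j(λ)` by (P2) and `l ∤ e(w|v)` because
`e(w|v) ∣ [F' : F_tpd] ∣ 46080 = 2^{10}·3^2·5` (the tree's `ramificationIdx_dvd_finrank_of_isGalois`).
[cite: Mochizuki2012, IUTchIV Cor 2.2 proof (P2)/(P4) p.45] -/
theorem not_dvd_localHeight_of_condP2 [IsGalois P.F Q.F] (hdeg : Module.finrank P.F Q.F ∣ 46080)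
    {l : ℕ} (hl : l.Prime) (h7 : 7 ≤ l) (hP2 : CondP2 P l) (w : HeightOneSpectrum (𝓞 Q.F))
    (hw : Q.W.HasMultiplicativeReductionAt w) : ¬ ((l : ℤ) ∣ Q.localHeight w) := by
  -- the place `v` of `F_tpd` under `w`
  haveI : (w.asIdeal.under (𝓞 P.F)).IsPrime := Ideal.IsPrime.under (𝓞 P.F) w.asIdeal
  set v : HeightOneSpectrum (𝓞 P.F) :=
    ⟨w.asIdeal.under (𝓞 P.F), inferInstance, Ideal.under_ne_bot (A := 𝓞 P.F) w.ne_bot⟩ with hv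
  haveI hover : w.asIdeal.LiesOver v.asIdeal := Ideal.over_under (A := 𝓞 P.F) w.asIdeal
  haveI : v.asIdeal.IsMaximal := v.isMaximal
  haveI : w.asIdeal.IsPrime := w.isPrime
  have hloc := localHeight_eq_mul Q hj w v
  rw [Ideal.ramificationIdx'_eq_ramificationIdx (p := v.asIdeal) (q := w.asIdeal) v.ne_bot] at hloc
  have hpos := Q.localHeight_pos_of_hasMultiplicativeReductionAt w hw
  -- `e(w|v) ∣ [F' : F_tpd] ∣ 46080`, so `l ∤ e(w|v)`
  have he : w.asIdeal.ramificationIdx (𝓞 P.F) ∣ 46080 :=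
    (Literature.NumberTheory.NumberFields.ramificationIdx_dvd_finrank_of_isGalois v.asIdeal w.asIdeal).trans
      hdeg
  have hle : ¬ l ∣ w.asIdeal.ramificationIdx (𝓞 P.F) := fun h =>
    not_dvd_46080_of_prime_of_seven_le hl h7 (h.trans he)
  -- `ord_v j(λ) < 0` since `h_w > 0`, so `l ∤ ord_v j(λ)` by (P2)
  have hord : ord P.F v (jInv P.x) < 0 := by
    rw [hloc] at hpos
    by_contra hge
    push Not at hge
    have : (w.asIdeal.ramificationIdx (𝓞 P.F) : ℤ) * (-ord P.F v (jInv P.x)) ≤ 0 :=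
      mul_nonpos_of_nonneg_of_nonpos (Int.natCast_nonneg _) (by omega)
    exact absurd hpos (not_lt.mpr this)
  have hP2v := hP2 v hord
  rw [hloc]
  intro hdvd
  have hlp : Prime (l : ℤ) := Nat.prime_iff_prime_int.mp hl
  rcases hlp.dvd_or_dvd hdvd with h1 | h2
  · exact hle (Int.natCast_dvd_natCast.mp h1)
  · exact hP2v ((dvd_neg).mp h2)

/-- **(P2) + (P4) + (P5) ⇒ (P6) for `Q`** (p. 46: "since, by (P5), `E_F` has bad multiplicative reduction at
some valuation `∈ 𝕍^bad_mod ≠ ∅`, (P6) follows formally from (P2), (P4), and [GenEll], Lemma 3.1, (iii)"):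
for `Q = E_{F'}` semistable with `j(Q) = j(λ)`, `F'/F_tpd` Galois of degree dividing `46080`, a prime `l ≥ 7`
with (P2) and (P5): if `Q` admits no `l`-cyclic subgroup scheme then the image of `Gal(F̄'/F')` on `Q[l]`
contains `SL₂(𝔽_l)`. The (P5) place `v ∤ 2l` of `F_tpd` with `ord_v j(λ) < 0` lifts to a place `w ∤ l` of
`F'`, of multiplicative reduction since `Q` is semistable and `h_w > 0`, with `l ∤ h_w = ord_w(Δ_min)`;
there the tree's Tate-curve transvection and [GenEll] Lem. 3.1 (iii) apply
(`EllPoint.imageModLContainsSL2_of_not_admitsLCyclic_of_hasMultiplicativeReductionAt`).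
[cite: Mochizuki2012, IUTchIV Cor 2.2 proof (P6) p.46] -/
theorem imageModLContainsSL2_of_condP5 [IsGalois P.F Q.F] (hdeg : Module.finrank P.F Q.F ∣ 46080)
    (hss : Q.IsSemistable) {l : ℕ} [Fact l.Prime] (h7 : 7 ≤ l) (hP2 : CondP2 P l) (hP5 : CondP5 P l)
    (hno : ¬ Q.AdmitsLCyclic l) : Q.ImageModLContainsSL2 l := by
  have hl : l.Prime := Fact.out
  obtain ⟨v, hvj, -, hvl⟩ := hP5
  -- a place `w` of `F'` over `v`
  haveI : v.asIdeal.IsMaximal := v.isMaximal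
  obtain ⟨⟨Pw, hPw⟩⟩ := (inferInstance : Nonempty (Ideal.primesOver v.asIdeal (𝓞 Q.F)))
  haveI : Pw.IsPrime := hPw.1
  haveI : Pw.LiesOver v.asIdeal := hPw.2
  let w : HeightOneSpectrum (𝓞 Q.F) := ⟨Pw, hPw.1, Ideal.ne_bot_of_liesOver_of_ne_bot v.ne_bot Pw⟩
  haveI hwv : w.asIdeal.LiesOver v.asIdeal := hPw.2
  -- `h_w(Q) > 0`, so `w` is a place of multiplicative reduction (semistability)
  have hloc := localHeight_eq_mul Q hj w v
  have he0 : v.asIdeal.ramificationIdx' w.asIdeal ≠ 0 :=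
    Ideal.IsDedekindDomain.ramificationIdx'_ne_zero_of_liesOver w.asIdeal v.ne_bot
  have hpos : 0 < Q.localHeight w := by
    rw [hloc]
    exact mul_pos (by exact_mod_cast Nat.pos_of_ne_zero he0) (by omega)
  have hmult : Q.W.HasMultiplicativeReductionAt w := by
    by_contra hm
    have h0 := Q.localHeight_nonpos_of_hasGoodReductionAt w
      (Q.hasGoodReductionAt_of_not_hasMultiplicativeReductionAt hss w hm)
    omega
  -- `w ∤ l`
  have hwl : (l : 𝓞 Q.F) ∉ w.asIdeal := by
    intro hmem
    apply hvl
    have h2 : (l : 𝓞 P.F) ∈ w.asIdeal.under (𝓞 P.F) := by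
      rw [Ideal.mem_comap, map_natCast]
      exact hmem
    rwa [← Ideal.LiesOver.over (P := w.asIdeal) (p := v.asIdeal)] at h2
  -- `l ∤ ord_w(Δ_min) = h_w`
  have hndvd : ¬ l ∣ Q.W.ordMinimalDiscriminant w := by
    rw [← Q.natCast_dvd_localHeight_iff hmult]
    exact not_dvd_localHeight_of_condP2 Q hj hdeg hl h7 hP2 w hmult
  exact Q.imageModLContainsSL2_of_not_admitsLCyclic_of_hasMultiplicativeReductionAt l hno hmult hwl hndvd

omit hj Q in
/-- **(P4), quantitative form** (p. 45: "the existence of an `l`-cyclic subgroup scheme of `E_F` would imply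
that … `log(q^∀)` is bounded"): for every compactly bounded `K_V` there is `H_K` such that for
`λ ∈ K_V`, every semistable `Q = E_{F'}` with `j(Q) = j(λ)`, `F'/F_tpd` Galois of degree dividing `46080`,
and every prime `l ≥ 7` with (P2), if `Q` admits an `l`-cyclic subgroup scheme then `log(q^∀(λ)) ≤ H_K`.
From `exists_htInf_le_of_admitsLCyclic` ([GenEll] Lem. 3.5 + Prop. 3.4, abc-iut-S-d4) through the dictionary
above and `log(q^∀) ≤ ht_∞` (Cor. 2.2 (i)). [cite: Mochizuki2012, IUTchIV Cor 2.2 proof (P4) p.45] -/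
theorem exists_logQForall_le_of_admitsLCyclic (D : CBData) :
    ∃ HK : ℝ, ∀ P : NFPoint, D.Mem P → ∀ (Q : EllPoint) [Algebra P.F Q.F] [IsGalois P.F Q.F],
      Module.finrank P.F Q.F ∣ 46080 → Q.W.j = algebraMap P.F Q.F (jInv P.x) → Q.IsSemistable →
        ∀ l : ℕ, l.Prime → 7 ≤ l → CondP2 P l → Q.AdmitsLCyclic l → logQForall P ≤ HK := by
  obtain ⟨C, hC⟩ := exists_jInv_bound D
  obtain ⟨B, hB⟩ := exists_htInf_le_of_admitsLCyclic C
  refine ⟨B, fun P hPD Q _ _ hdeg hj hss l hl h7 hP2 hcyc => ?_⟩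
  have h1 := hB Q l hl hss (norm_j_le_of_mem Q hj hPD hC)
    (not_dvd_localHeight_of_condP2 Q hj hdeg hl h7 hP2) hcyc
  rw [htInf_eq_htInfty Q hj] at h1
  exact (logQForall_le_htInfty P).trans h1

end Dictionary

/-! ## (P4) ⇒ (P6) on a compactly bounded subset -/

/-- **[IUTchIV] Cor. 2.2 (ii), the classical Galois-image input (P4) ⇒ (P6), PROVED for primes `l ≥ 7`**
(the statement of `Cor22.FullGaloisImage`, rev 2): for every compactly bounded `K_V` there is `H_K`
(depending only on `K_V`) such that for `λ ∈ K_V ∩ U_X`, primes `l ≥ 7` with (P2), (P5) and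
`H_K < log(q^∀(λ))`, condition (P6) holds: `h > H_K` excludes an `l`-cyclic subgroup scheme of `E_F`
(`exists_logQForall_le_of_admitsLCyclic`), whence (P6) (`imageModLContainsSL2_of_condP5`), for every
theta-field `F` (semistable by `IsThetaField.isSemistable`, Galois of degree `∣ 46080` by
`IsThetaField.isGalois`/`finrank_dvd`). The hypotheses `Hypotheses D` and `P ∈ U_P` of the interface
are not needed. [cite: Mochizuki2012, IUTchIV Cor 2.2 proof (P4)–(P6) pp.45–46] -/
theorem condP6_of_seven_le (D : CBData) :
    ∃ HK : ℝ, ∀ P : NFPoint, P ∈ D.toSet → P ∈ UP → ∀ l : ℕ, l.Prime → 7 ≤ l →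
      CondP2 P l → CondP5 P l → HK < logQForall P → CondP6 P l := by
  obtain ⟨HK, hHK⟩ := exists_logQForall_le_of_admitsLCyclic D
  refine ⟨HK, fun P hPD _ l hl h7 hP2 hP5 hh => ?_⟩
  intro hU F _ _ _ hF _
  haveI : Fact l.Prime := ⟨hl⟩
  letI iA : Algebra P.F (thetaEllPoint P hU F).F := ‹Algebra P.F F›
  haveI iG : IsGalois P.F (thetaEllPoint P hU F).F := hF.isGalois
  have hdeg : Module.finrank P.F (thetaEllPoint P hU F).F ∣ 46080 := hF.finrank_dvd
  have hj : (thetaEllPoint P hU F).W.j = algebraMap P.F (thetaEllPoint P hU F).F (jInv P.x) :=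
    thetaCurve_j F hU
  have hss : (thetaEllPoint P hU F).IsSemistable := hF.isSemistable
  refine imageModLContainsSL2_of_condP5 (thetaEllPoint P hU F) hj hdeg hss h7 hP2 hP5 ?_
  intro hcyc
  have := hHK P hPD (thetaEllPoint P hU F) hdeg hj hss l hl h7 hP2 hcyc
  linarith

end Cor22

end Literature.IUT.LogVolume

end
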